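import Literature.AnabelianGeometry.EtaleTheta.Discharge.Sec4BaseShapeOfConnectedTemperoid
import Literature.AnabelianGeometry.EtaleTheta.Discharge.Sec5TowerOfConnectedTemperoid

/-!
# [EtTh] Thm. 4.4 / Prop. 5.1 for a self-equivalence over `B^temp(Π^tp_X)⁰` in a GENERAL category vocabulary:
# the binder `h44 : Thm44Hyp S S` of the Thm. 5.7 FINAL KNIT, PRODUCED modulo «`Ψ` induces `Ψ^bs`» and Prop. 2.4

S. Mochizuki, *The étale theta function and its Frobenioid-theoretic manifestations*, Publ. RIMS **45** (2009)
[MochizukiEtTh2009], Thm. 4.4 p.319 (PDF p.93): «`Ψ : C₁ ⥲ C₂` which induces … an equivalence `Ψ^bs : D₁ ⥲ D₂` that maps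
`A_{⊙,1}^bs` to an isomorph of `A_{⊙,2}^bs`»; §5 p.322–323 (PDF pp.96–97); Thm. 5.7 pp.329–330 (PDF pp.103–104).

abc-iut cell, layer L2, ROW R251 lineage (seat abc-iut-w4-d008 gen 5), FILE 5 — PROOF-ONLY.  FILES 2–3 (p443466, p445052) produce
abc-iut-L2-t3's `Thm44Hyp S S` for every self-equivalence over the TREE vocabularies (`treeCatVocab`/`treeMonoidVocab`), where
«`Ψ` induces `Ψ^bs`» is a THEOREM ([FrdI] Thm. 3.4 (v), abc-iut-L2-t9's `exists_baseEquiv_treeCatVocab`).  The Thm. 5.7 FINAL KNIT of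
the abc-iut-L2-d4 / abc-iut-w5-d245 lineages (`Sec5Thm57CoherentFamilyOfRebase`, p445776) is stated over a GENERAL vocabulary
`VD : FrdICatStub` and carries `h44 : Thm44Hyp (mkOfConnectedTemperoidYddTower …) (…)` and `hP24` (∀γ-stability of `Π^tp_Ÿ`) as
binders.  This file produces `h44` THERE:
* `BiKummerSetting.exists_thm44Hyp_self_of_baseEquiv_of_isTopCharacteristic` — at `mkOfConnectedTemperoid` over ANY `VD`:
  `∃ hh : Thm44Hyp S S, hh.Ψ = Ψ` ⇐ {`hnd` ("`Φ` non-dilating"), `hshape` ("`D = D₀[𝒟]`"), **`hΨbs` («`Ψ` induces some `Ψ^bs` with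
  `Base ∘ Ψ ≅ Ψ^bs ∘ Base`» — [FrdI] Thm. 3.4 (v); a theorem at the tree vocabulary, a binder here, named `hΨbs`)**, `hc : IsTopCharacteristic X.Pi H_⊙`}
  — `hopen` (abc-iut-L2-t4) and `hchar` (FILE 1) being theorems; `…_of_base_isEquivalence` drops `hshape` when the Def. 3.3 reference
  functor is an equivalence (FILE 3);
* `BiKummerSetting.exists_thm44Hyp_mkOfConnectedTemperoidYddTower` — **the `h44` binder of p445776 VERBATIM**: at
  `S := mkOfConnectedTemperoidYddTower X tf hZ hP NH 𝒯 ιX`, for every `Ψ`, `∃ hh : Thm44Hyp S S, hh.Ψ = Ψ` ⇐ {`hnd`, `hshape`, `hΨbs`,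
  **`hP24 : ∀ γ : 𝒯.PiX ≃ₜ* 𝒯.PiX, 𝒯.PiYdd.map γ = 𝒯.PiYdd`** (the knit's own binder, = `IsTopCharacteristic 𝒯.PiX 𝒯.PiYdd` by `Iff.rfl`)};
  `…_of_base_isEquivalence` form without `hshape`.
HONEST FRAMING: kernel-checked compositions; «`Ψ` induces `Ψ^bs`» and the Prop. 2.4 clause stay hypotheses BY NAME at the general
vocabulary; nothing here bears on [IUTchIII] Cor. 3.12 — no side is taken; typed ≠ proved for the genuine data.
-/

noncomputable section

open CategoryTheory

namespace Literature.AnabelianGeometry.EtaleTheta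

open Literature.AlgebraicGeometry.Frobenioids Literature.AnabelianGeometry.SemiGraphs

namespace BiKummerSetting

universe u₀ v₀ w

variable {K : Type u₀} [Field K] (X : SemiGraphs.TemperedArithmeticGroup.{u₀} K) {D₀ : Type u₀} [Category.{v₀} D₀]
  {V : FrdIMonoidStub.{w}} {T₀ : RealifiedDivisorMonoids (D₀ := D₀) V}
  {VD : FrdICatStub.{u₀ + 1, u₀, w} (ConnectedPart (BTemp X.Pi))}
  (tf : TemperedFrobenioid T₀ (ConnectedPart (BTemp X.Pi)) VD) (hZ : tf.monoidType = MonoidType.Z)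
  (hP : ∀ A : (ConnectedPart (BTemp X.Pi))ᵒᵖ, IsPerfect (tf.Φ.carrier A))
  (NH : Subgroup (Field.absoluteGaloisGroup K) → tf.category → ℕ+ → Prop)

/-! ### General vocabulary, arbitrary Galois `A_⊙` -/

section General

variable (A₀ : tf.category) (hA₀ : PreFrobenioid.IsFrobeniusTrivial tf.toElem A₀) (hA₀' : SemiGraphs.IsGaloisObj A₀.base.obj)

/-- **`Thm44Hyp S S` for a self-equivalence `Ψ` over `B^temp(Π^tp_X)⁰` in a GENERAL vocabulary `VD`** (abc-iut-L2-t9's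
`exists_thm44Hyp_self_of_characteristic` with `hopen` := abc-iut-L2-t4's `isOpen_Hodot_mkOfConnectedTemperoid` and `hchar` := FILE 1):
residual {`hnd`, `hshape`, `hΨbs` («`Ψ` induces `Ψ^bs`», [FrdI] Thm. 3.4 (v)), `hc : IsTopCharacteristic X.Pi H_⊙`}.
[cite: MochizukiEtTh2009, Thm 4.4 p.319 (PDF p.93); §5 p.322–323 (PDF pp.96–97)] -/
theorem exists_thm44Hyp_self_of_baseEquiv_of_isTopCharacteristic (Ψ : tf.category ≌ tf.category)
    (hnd : ∀ (A : (ConnectedPart (BTemp X.Pi))ᵒᵖ) (φ : A ⟶ A), V.IsNonDilating (tf.Φ.carrier A) (tf.Φ.pull φ))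
    (hshape : tf.base.Full ∧ tf.base.Faithful ∧
      ∃ 𝒟 : D₀, ∀ Y : D₀, (∃ A : ConnectedPart (BTemp X.Pi), Nonempty (tf.base.obj A ≅ Y)) ↔ Nonempty (Y ⟶ 𝒟))
    (hΨbs : ∃ Ψbs : ConnectedPart (BTemp X.Pi) ≌ ConnectedPart (BTemp X.Pi),
      Nonempty ((mkOfConnectedTemperoid X tf hZ hP NH A₀ hA₀ hA₀').base ⋙ Ψbs.functor ≅
        Ψ.functor ⋙ (mkOfConnectedTemperoid X tf hZ hP NH A₀ hA₀ hA₀').base))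
    (hc : IsTopCharacteristic X.Pi (mkOfConnectedTemperoid X tf hZ hP NH A₀ hA₀ hA₀').Hodot) :
    ∃ hh : Thm44Hyp (mkOfConnectedTemperoid X tf hZ hP NH A₀ hA₀ hA₀') (mkOfConnectedTemperoid X tf hZ hP NH A₀ hA₀ hA₀'),
      hh.Ψ = Ψ :=
  (mkOfConnectedTemperoid X tf hZ hP NH A₀ hA₀ hA₀').exists_thm44Hyp_self_of_characteristic Ψ hnd hshape
    (isOpen_Hodot_mkOfConnectedTemperoid X tf hZ hP NH A₀ hA₀ hA₀') hΨbs
    (hchar_mkOfConnectedTemperoid_of_isTopCharacteristic' X tf hZ hP NH A₀ hA₀ hA₀' hc)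

/-- The same with `hshape` DISCHARGED when the Def. 3.3 reference functor `tf.base` is an equivalence (FILE 3's
`hshape_of_base_isEquivalence`): residual {`hnd`, `hΨbs`, `hc`}. [cite: MochizukiEtTh2009, §5 p.322 (PDF p.96)] -/
theorem exists_thm44Hyp_self_of_baseEquiv_of_base_isEquivalence [tf.base.IsEquivalence] (Ψ : tf.category ≌ tf.category)
    (hnd : ∀ (A : (ConnectedPart (BTemp X.Pi))ᵒᵖ) (φ : A ⟶ A), V.IsNonDilating (tf.Φ.carrier A) (tf.Φ.pull φ))
    (hΨbs : ∃ Ψbs : ConnectedPart (BTemp X.Pi) ≌ ConnectedPart (BTemp X.Pi),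
      Nonempty ((mkOfConnectedTemperoid X tf hZ hP NH A₀ hA₀ hA₀').base ⋙ Ψbs.functor ≅
        Ψ.functor ⋙ (mkOfConnectedTemperoid X tf hZ hP NH A₀ hA₀ hA₀').base))
    (hc : IsTopCharacteristic X.Pi (mkOfConnectedTemperoid X tf hZ hP NH A₀ hA₀ hA₀').Hodot) :
    ∃ hh : Thm44Hyp (mkOfConnectedTemperoid X tf hZ hP NH A₀ hA₀ hA₀') (mkOfConnectedTemperoid X tf hZ hP NH A₀ hA₀ hA₀'),
      hh.Ψ = Ψ :=
  exists_thm44Hyp_self_of_baseEquiv_of_isTopCharacteristic X tf hZ hP NH A₀ hA₀ hA₀' Ψ hnd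
    (hshape_of_base_isEquivalence X tf) hΨbs hc

end General

/-! ### The §5 tower setting `mkOfConnectedTemperoidYddTower` (`A_⊙^bs := Ÿ`): the `h44` binder of the Thm. 5.7 final knit -/

section Tower

variable {E : Set ℕ+} (𝒯 : ThetaEnvTower.{max u₀ w} E) (ιX : 𝒯.PiX ≃ₜ* X.Pi)

/-- **The binder `h44 : Thm44Hyp S S` of the Thm. 5.7 final knit (`Sec5Thm57CoherentFamilyOfRebase`, p445776), PRODUCED** at
`S := mkOfConnectedTemperoidYddTower X tf hZ hP NH 𝒯 ιX` for every self-equivalence `Ψ`, modulo {`hnd`, `hshape`, `hΨbs` («`Ψ` induces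
`Ψ^bs`»), `hP24`} — `hP24` being the knit's OWN Prop. 2.4 binder (∀γ-stability of `Π^tp_Ÿ` in `Π^tp_X`), read here through FILE 1's
`hchar_mkOfConnectedTemperoidYdd_of_isTopCharacteristic`. [cite: MochizukiEtTh2009, Thm 5.7 p.329–330 (PDF pp.103–104)] -/
theorem exists_thm44Hyp_mkOfConnectedTemperoidYddTower (Ψ : tf.category ≌ tf.category)
    (hnd : ∀ (A : (ConnectedPart (BTemp X.Pi))ᵒᵖ) (φ : A ⟶ A), V.IsNonDilating (tf.Φ.carrier A) (tf.Φ.pull φ))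
    (hshape : tf.base.Full ∧ tf.base.Faithful ∧
      ∃ 𝒟 : D₀, ∀ Y : D₀, (∃ A : ConnectedPart (BTemp X.Pi), Nonempty (tf.base.obj A ≅ Y)) ↔ Nonempty (Y ⟶ 𝒟))
    (hΨbs : ∃ Ψbs : ConnectedPart (BTemp X.Pi) ≌ ConnectedPart (BTemp X.Pi),
      Nonempty ((mkOfConnectedTemperoidYddTower X tf hZ hP NH 𝒯 ιX).base ⋙ Ψbs.functor ≅
        Ψ.functor ⋙ (mkOfConnectedTemperoidYddTower X tf hZ hP NH 𝒯 ιX).base))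
    (hP24 : ∀ γ : 𝒯.PiX ≃ₜ* 𝒯.PiX, 𝒯.PiYdd.map γ.toMulEquiv.toMonoidHom = 𝒯.PiYdd) :
    ∃ hh : Thm44Hyp (mkOfConnectedTemperoidYddTower X tf hZ hP NH 𝒯 ιX) (mkOfConnectedTemperoidYddTower X tf hZ hP NH 𝒯 ιX),
      hh.Ψ = Ψ :=
  (mkOfConnectedTemperoidYddTower X tf hZ hP NH 𝒯 ιX).exists_thm44Hyp_self_of_characteristic Ψ hnd hshape
    (isOpen_Hodot_mkOfConnectedTemperoid X tf hZ hP NH _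
      (mkOfConnectedTemperoidYddTower X tf hZ hP NH 𝒯 ιX).isFrobeniusTrivial_Aodot
      (mkOfConnectedTemperoidYddTower X tf hZ hP NH 𝒯 ιX).isGalois_Aodot) hΨbs
    (hchar_mkOfConnectedTemperoidYdd_of_isTopCharacteristic X tf hZ hP NH (𝒯.level ⟨1, 𝒯.one_mem⟩) ιX hP24)

/-- The same with `hshape` DISCHARGED when `tf.base` is an equivalence: `h44` ⇐ {`hnd`, `hΨbs`, `hP24`}.
[cite: MochizukiEtTh2009, Thm 5.7 p.329–330 (PDF pp.103–104)] -/
theorem exists_thm44Hyp_mkOfConnectedTemperoidYddTower_of_base_isEquivalence [tf.base.IsEquivalence]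
    (Ψ : tf.category ≌ tf.category)
    (hnd : ∀ (A : (ConnectedPart (BTemp X.Pi))ᵒᵖ) (φ : A ⟶ A), V.IsNonDilating (tf.Φ.carrier A) (tf.Φ.pull φ))
    (hΨbs : ∃ Ψbs : ConnectedPart (BTemp X.Pi) ≌ ConnectedPart (BTemp X.Pi),
      Nonempty ((mkOfConnectedTemperoidYddTower X tf hZ hP NH 𝒯 ιX).base ⋙ Ψbs.functor ≅
        Ψ.functor ⋙ (mkOfConnectedTemperoidYddTower X tf hZ hP NH 𝒯 ιX).base))
    (hP24 : ∀ γ : 𝒯.PiX ≃ₜ* 𝒯.PiX, 𝒯.PiYdd.map γ.toMulEquiv.toMonoidHom = 𝒯.PiYdd) :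
    ∃ hh : Thm44Hyp (mkOfConnectedTemperoidYddTower X tf hZ hP NH 𝒯 ιX) (mkOfConnectedTemperoidYddTower X tf hZ hP NH 𝒯 ιX),
      hh.Ψ = Ψ :=
  exists_thm44Hyp_mkOfConnectedTemperoidYddTower X tf hZ hP NH 𝒯 ιX Ψ hnd (hshape_of_base_isEquivalence X tf) hΨbs hP24

end Tower

end BiKummerSetting

end Literature.AnabelianGeometry.EtaleTheta

end
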